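import Literature.AlgebraicGeometry.Surfaces.K3PowersHodgeOfTranscendentalLattice
import Literature.AlgebraicGeometry.HodgeTheory.HodgeConjectureIsogenyInvariance
import Literature.AlgebraicGeometry.Surfaces.K3PicardSixteenFamiliesPowersHodge

/-!
# Route MarkmanPartnerTransport · crux `PicardThreeK3Squares` (stmt-HodgeConjecture-19652) —
# the Kuga–Satake sector: K3 surfaces with `T(S)_ℚ ↪ U³ ⊕ ⟨-m⟩` (Floccari 2026, by name)

The crux `PicardThreeK3Squares` (HC⁴ of `S × S` for projective K3 surfaces `S` with `ρ(S) ≥ 3`) is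
open exactly on the real-multiplication ranks `ρ(S) ∈ {4, 6, 7, 8, 10, 12, 13, 14, 16}`
(`Theorems/…RealMultiplicationRanksCorollaries`). This file records, in the crux's own vocabulary
(marked K3 surfaces), the KUGA–SATAKE SECTOR in print that meets that list — at `ρ(S) = 16` only,
since `T(S)_ℚ` has signature `(2, 20 - ρ)` and `U³ ⊕ ⟨-m⟩` has signature `(3, 4)`:

* `hodgeConjectureFor_square_of_transcendental_embedding` — **HC for `S ⊗ S` for every projective K3
  surface whose rational transcendental lattice, read in a marking `(η, p)`, embeds isometrically into
  `(U³ ⊕ ⟨-m⟩) ⊗ ℚ` for some `m > 0`**, modulo the named fact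
  `Floccari2026_hodgeClasses_algebraic_powers_of_K3_of_transcendental_embedding` (Floccari, Geom.
  Topol. 30 (2026), Thm. 5.11 (ii): every power of such an `S` satisfies the Hodge conjecture); the
  only work here is `S^2 = (Spec ℂ ⊗ S) ⊗ S ≅ S ⊗ S` (left unitor) and the transport of
  `HodgeConjectureFor` along an isomorphism (`HodgeConjectureFor.of_surjective`).
* `hodgeConjectureFor_powers_of_transcendental_le_U2ab` /
  `hodgeConjectureFor_square_of_transcendental_le_U2ab` (gen 2, second landing) — the same sector in
  LATTICE terms: if `T(S)_ℚ`, read in the marking, lies in the `ℚ`-span of six vectors with Gram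
  matrix `U ⊕ U ⊕ ⟨a⟩ ⊕ ⟨b⟩` (`picardSixteenGram a b`, `a ≠ 0`, `b < 0`; at `ρ(S) = 16` this is
  Varesco's "`T(𝒳_s) ≃ U_ℚ² ⊕ ⟨a⟩ ⊕ ⟨b⟩`", i.e. Witt index two), then the Floccari embedding into
  `U³ ⊕ ⟨b⟩ = U³ ⊕ ⟨-m⟩` is written down explicitly (`v₄ ↦ e₃ + (a/2) f₃`, `v₅ ↦ g`), so HC holds for
  all powers of `S` and for `S ⊗ S` — Varesco 2025 Thm. 0.2 without its family / Kuga–Satake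
  hypotheses, at the price of Floccari's fact. The residue of the crux at `ρ = 16` is therefore the
  K3 surfaces whose `T(S)_ℚ` has Witt index `1`.

No definition, no sorry; the named fact enters as a hypothesis (conditional result). Prover seat
hodge-nonav-19652-p1 (gen 2), `--supports stmt-HodgeConjecture-19652`.

References: S. Floccari, *K3 surfaces associated with varieties of generalized Kummer type*, Geom.
Topol. 30 (2026) 1129–1154, Thm. 5.11; M. Varesco, Michigan Math. J. (2025) (the `ρ = 16` families).
-/

set_option linter.dupNamespace false

noncomputable section

namespace Summit.HodgeConjecture.HodgeConjecture.Theorems.MarkmanPartnerTransport.KugaSatakeSector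

open CategoryTheory MonoidalCategory
open Literature.AlgebraicGeometry Literature.AlgebraicGeometry.Motives Literature.AlgebraicGeometry.HodgeTheory
open Literature.AlgebraicGeometry.Surfaces
open Literature.AlgebraicTopology.SingularHomology

variable {S : SchemeOver ℂ}

/-! ### `S^2 ≅ S ⊗ S` and transport of the Hodge statement -/

/-- **The Hodge statement passes from the cartesian square `S^2 = (Spec ℂ ⊗ S) ⊗ S` (the tree's
`SchemeOver.pow`) to `S ⊗ S`**: transport along the isomorphism `λ_ S ▷ S` (left unitor on the
first factor), an isomorphism being surjective (`HodgeConjectureFor.of_surjective`). [folklore] -/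
theorem hodgeConjectureFor_tensor_self_of_pow_two (hS : IsSmoothProjective 2 S)
    (h : HodgeConjectureFor 4 (S.pow 2)) : HodgeConjectureFor 4 (S ⊗ S) := by
  have hpow : IsSmoothProjective 4 (S.pow 2) := hS.pow 2
  let e : S.pow 2 ≅ S ⊗ S := whiskerRightIso (λ_ S) S
  haveI : IsIso e.hom.left := by
    change IsIso ((Over.forget _).map e.hom)
    infer_instance
  exact h.of_surjective hpow (IsSmoothProjective.tensor_holds hS hS) e.hom

/-! ### The Kuga–Satake sector of the crux -/

/-- **HC for `S ⊗ S` on the Kuga–Satake sector `T(S)_ℚ ↪ U³ ⊕ ⟨-m⟩`**, modulo Floccari's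
Thm. 5.11 (ii) by name: for a projective K3 surface `S` with a marking `(η, p)` (the clauses of
`Huybrechts_K3_marking_exists`: `p ≠ 0` an integral generator of `H⁴(S(ℂ); ℂ)`, integral classes of
`H²` `↔ ℤ²²` under `η`, `a ∪ b = k3Form (η a) (η b) • p`) and a `ℚ`-linear `ι : ℚ²² → ℚ⁷` which is
isometric (`u3mFormQ m (ι v) (ι w) = k3FormRat v w`) and injective on the transcendental coordinate
vectors (`IsTranscendentalCoord S η`), `0 < m`, the Hodge conjecture holds for `S ⊗ S`. Within the
crux `PicardThreeK3Squares` this is the part of the rank `ρ(S) = 16` in print (signatures: `T(S)_ℚ`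
is `(2, 20 - ρ)`, the target `(3, 4)`). [cite: Floccari2026, Thm. 5.11 (§5)]
[cite: Huybrechts2016K3, Ch. 1 Prop. 3.5] -/
theorem hodgeConjectureFor_square_of_transcendental_embedding
    (hF : Floccari2026_hodgeClasses_algebraic_powers_of_K3_of_transcendental_embedding)
    (hS : IsK3Surface S)
    (η : complexBetti S (2 * 1) ≃ₗ[ℂ] (K3Index → ℂ)) (p : complexBetti S (2 * 2))
    (hp : p ≠ 0) (hpi : IsIntegralClass p)
    (hgen : ∀ q : complexBetti S (2 * 2), IsIntegralClass q → ∃ n : ℤ, q = n • p)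
    (hint : ∀ c : complexBetti S (2 * 1), IsIntegralClass c ↔ ∃ v : K3Index → ℤ, η c = fun i => (v i : ℂ))
    (hcup : ∀ a b : complexBetti S (2 * 1),
      cupProduct (rfl : 2 * 1 + 2 * 1 = 2 * 2) a b = k3Form (η a) (η b) • p)
    {m : ℕ} (hm : 0 < m) (ι : (K3Index → ℚ) →ₗ[ℚ] (U3mIndex → ℚ))
    (hiso : ∀ v w : K3Index → ℚ, IsTranscendentalCoord S η v → IsTranscendentalCoord S η w →
      u3mFormQ m (ι v) (ι w) = k3FormRat v w)
    (hinj : ∀ v : K3Index → ℚ, IsTranscendentalCoord S η v → ι v = 0 → v = 0) :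
    HodgeConjectureFor 4 (S ⊗ S) :=
  hodgeConjectureFor_tensor_self_of_pow_two hS.isSmoothProjective
    (hF.square hS η p hp hpi hgen hint hcup hm ι hiso hinj)

/-! ### The sector in lattice terms: `T(S)_ℚ` inside `U_ℚ² ⊕ ⟨a⟩ ⊕ ⟨b⟩` (Witt index two) -/

/-- The rational form `u3mFormQ m` of `U³ ⊕ ⟨-m⟩` is the Mathlib bilinear form of its Gram matrix.
[cite: Floccari2026, Thm. 5.11 (§5)] -/
theorem u3mFormQ_eq_toBilin' (m : ℕ) (x y : U3mIndex → ℚ) :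
    u3mFormQ m x y = Matrix.toBilin' ((u3mGram m).map (Int.cast : ℤ → ℚ)) x y := by
  rw [Matrix.toBilin'_apply]
  rfl

/-- The Gram matrix `G(a,b) = U ⊕ U ⊕ ⟨a⟩ ⊕ ⟨b⟩` (`picardSixteenGram`) with `a, b ≠ 0` is
non-degenerate: a coefficient vector `c` with `Σᵢ cᵢ G(a,b)ᵢⱼ = 0` for every `j` vanishes.
[cite: Varesco2025, Thm. 4.3 (§4) (the lattice `U_ℚ² ⊕ ⟨a⟩ ⊕ ⟨b⟩`)] -/
theorem eq_zero_of_sum_mul_picardSixteenGram {a b : ℤ} (ha : a ≠ 0) (hb : b ≠ 0) (c : Fin 6 → ℚ)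
    (h : ∀ j, ∑ i, c i * (picardSixteenGram a b i j : ℚ) = 0) : c = 0 := by
  have h0 := h 0
  have h1 := h 1
  have h2 := h 2
  have h3 := h 3
  have h4 := h 4
  have h5 := h 5
  simp only [Fin.sum_univ_six, picardSixteenGram, Matrix.of_apply, Matrix.cons_val',
    Matrix.cons_val_zero, Matrix.cons_val_one, Matrix.cons_val, Matrix.empty_val',
    Matrix.cons_val_fin_one, Int.cast_zero, Int.cast_one, mul_zero, mul_one, add_zero,
    zero_add] at h0 h1 h2 h3 h4 h5
  have ha' : (a : ℚ) ≠ 0 := Int.cast_ne_zero.2 ha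
  have hb' : (b : ℚ) ≠ 0 := Int.cast_ne_zero.2 hb
  funext i
  fin_cases i
  · simpa using h1
  · simpa using h0
  · simpa using h3
  · simpa using h2
  · simpa [ha'] using h4
  · simpa [hb'] using h5

/-- **HC for all powers `Sᵏ` of a projective K3 surface whose rational transcendental lattice lies
in a space `U_ℚ² ⊕ ⟨a⟩ ⊕ ⟨b⟩` (`b < 0`, `a ≠ 0`)**, modulo Floccari's Thm. 5.11 (ii) by name.
Read in a marking `(η, p)` of `S` (clauses of `Huybrechts_K3_marking_exists`): if every
transcendental rational coordinate vector (`IsTranscendentalCoord S η`) lies in the `ℚ`-span of six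
vectors `v₀, …, v₅ ∈ ℚ²²` whose K3-form Gram matrix is `G(a,b) = U ⊕ U ⊕ ⟨a⟩ ⊕ ⟨b⟩`
(`picardSixteenGram a b`; for a K3 surface with `T(S)_ℚ ≅ U_ℚ² ⊕ ⟨a⟩ ⊕ ⟨b⟩`, `ρ(S) = 16`, this is
Varesco's hypothesis "`T(𝒳_s) ≃ U_ℚ² ⊕ ⟨a⟩ ⊕ ⟨b⟩`", i.e. WITT INDEX TWO), then `T(S)_ℚ` embeds
isometrically into `(U³ ⊕ ⟨-m⟩) ⊗ ℚ` with `m = -b`: send the two hyperbolic pairs to the first two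
copies of `U`, `v₄ ↦ e₃ + (a/2) f₃` (square `a`) and `v₅ ↦ g`, `g² = -m = b`; hence Floccari's theorem
applies. This removes the family and the Kuga–Satake hypotheses from the tree's record of Varesco
2025 Thm. 0.2 (`Varesco2025_hodgeClasses_algebraic_powers_picardSixteenFamily`) for such surfaces,
at the price of Floccari's fact. [cite: Floccari2026, Thm. 5.11 (§5)]
[cite: Varesco2025, Thm. 0.2 = Thm. 4.3 (§4)] [cite: Huybrechts2016K3, Ch. 1 Prop. 3.5] -/
theorem hodgeConjectureFor_powers_of_transcendental_le_U2ab
    (hF : Floccari2026_hodgeClasses_algebraic_powers_of_K3_of_transcendental_embedding)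
    (hS : IsK3Surface S)
    (η : complexBetti S (2 * 1) ≃ₗ[ℂ] (K3Index → ℂ)) (p : complexBetti S (2 * 2))
    (hp : p ≠ 0) (hpi : IsIntegralClass p)
    (hgen : ∀ q : complexBetti S (2 * 2), IsIntegralClass q → ∃ n : ℤ, q = n • p)
    (hint : ∀ c : complexBetti S (2 * 1), IsIntegralClass c ↔ ∃ v : K3Index → ℤ, η c = fun i => (v i : ℂ))
    (hcup : ∀ a b : complexBetti S (2 * 1),
      cupProduct (rfl : 2 * 1 + 2 * 1 = 2 * 2) a b = k3Form (η a) (η b) • p)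
    {a b : ℤ} (ha : a ≠ 0) (hb : b < 0) (v : Fin 6 → (K3Index → ℚ))
    (hspan : ∀ w : K3Index → ℚ, IsTranscendentalCoord S η w → w ∈ Submodule.span ℚ (Set.range v))
    (hG : ∀ i j, k3FormRat (v i) (v j) = (picardSixteenGram a b i j : ℚ)) (k : ℕ) :
    HodgeConjectureFor (k * 2) (S.pow k) := by
  classical
  -- pairing a combination of the `vᵢ` with `vⱼ`
  have hpair : ∀ (g : Fin 6 → ℚ) (j : Fin 6),
      k3FormRat (∑ i, g i • v i) (v j) = ∑ i, g i * (picardSixteenGram a b i j : ℚ) := by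
    intro g j
    simp only [map_sum, map_smul, LinearMap.sum_apply, LinearMap.smul_apply, smul_eq_mul, hG]
  -- the `vᵢ` are linearly independent (non-degenerate Gram matrix)
  have hli : LinearIndependent ℚ v := by
    rw [Fintype.linearIndependent_iff]
    intro g hg
    have hg0 : g = 0 := eq_zero_of_sum_mul_picardSixteenGram ha hb.ne g fun j => by
      rw [← hpair g j, hg, map_zero, LinearMap.zero_apply]
    exact fun i => congrFun hg0 i
  set W : Submodule ℚ (K3Index → ℚ) := Submodule.span ℚ (Set.range v) with hW
  let bW : Module.Basis (Fin 6) ℚ W := Module.Basis.span hli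
  -- the integer `m = -b > 0`
  set m : ℕ := b.natAbs with hm_def
  have hm : 0 < m := Int.natAbs_pos.2 hb.ne
  have hmQ : ((m : ℕ) : ℚ) = -(b : ℚ) := by
    have h : ((m : ℕ) : ℤ) = -b := by rw [hm_def, Int.natCast_natAbs, abs_of_neg hb]
    exact_mod_cast h
  -- the target vectors in `ℚ⁷ = (U ⊕ U ⊕ U ⊕ ⟨-m⟩) ⊗ ℚ`
  let c : Fin 6 → (U3mIndex → ℚ) :=
    ![Pi.single (Sum.inl (Sum.inl 0)) 1,
      Pi.single (Sum.inl (Sum.inl 1)) 1,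
      Pi.single (Sum.inl (Sum.inr (Sum.inl 0))) 1,
      Pi.single (Sum.inl (Sum.inr (Sum.inl 1))) 1,
      Pi.single (Sum.inl (Sum.inr (Sum.inr 0))) 1 +
        ((a : ℚ) / 2) • Pi.single (Sum.inl (Sum.inr (Sum.inr 1))) 1,
      Pi.single (Sum.inr ()) 1]
  have hcG : ∀ i j, u3mFormQ m (c i) (c j) = (picardSixteenGram a b i j : ℚ) := by
    intro i j
    rw [u3mFormQ_eq_toBilin']
    fin_cases i <;> fin_cases j <;>
      simp [c, u3mGram, hyperbolicPlaneGram, picardSixteenGram, Matrix.map_apply, map_add,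
        map_smul, LinearMap.add_apply, LinearMap.smul_apply, Matrix.toBilin'_single, hmQ]
  -- `ι₀` on `W`, extended to `ℚ²²`
  let ι₀ : W →ₗ[ℚ] (U3mIndex → ℚ) := bW.constr ℚ c
  have hι₀b : ∀ i, ι₀ (bW i) = c i := fun i => bW.constr_basis ℚ c i
  obtain ⟨ι, hι⟩ := LinearMap.exists_extend ι₀
  have hιW : ∀ (w : K3Index → ℚ) (hw : w ∈ W), ι w = ι₀ ⟨w, hw⟩ := fun w hw => by
    have h := LinearMap.congr_fun hι ⟨w, hw⟩
    simpa using h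
  -- `ι₀` is isometric on `W`
  have hisoW : ∀ x y : W, u3mFormQ m (ι₀ x) (ι₀ y) = k3FormRat (x : K3Index → ℚ) (y : K3Index → ℚ) := by
    let B₁ : LinearMap.BilinForm ℚ W := k3FormRat.comp W.subtype W.subtype
    let B₂ : LinearMap.BilinForm ℚ W :=
      (Matrix.toBilin' ((u3mGram m).map (Int.cast : ℤ → ℚ))).comp ι₀ ι₀
    have hB : B₂ = B₁ := LinearMap.BilinForm.ext_basis bW fun i j => by
      simp only [B₁, B₂, LinearMap.BilinForm.comp_apply, hι₀b, Submodule.coe_subtype]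
      rw [← u3mFormQ_eq_toBilin', hcG]
      have h1 : ((bW i : W) : K3Index → ℚ) = v i := Module.Basis.coe_span_apply hli i
      have h2 : ((bW j : W) : K3Index → ℚ) = v j := Module.Basis.coe_span_apply hli j
      rw [h1, h2, hG]
    intro x y
    have h := LinearMap.congr_fun (LinearMap.congr_fun hB x) y
    simp only [B₁, B₂, LinearMap.BilinForm.comp_apply, Submodule.coe_subtype] at h
    rw [u3mFormQ_eq_toBilin']
    exact h
  refine hF S hS η p hp hpi hgen hint hcup m hm ι (fun x y hx hy => ?_) (fun x hx hx0 => ?_) k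
  · rw [hιW x (hspan x hx), hιW y (hspan y hy), hisoW]
  · have hxW : x ∈ W := hspan x hx
    have horth : ∀ j, k3FormRat x (v j) = 0 := fun j => by
      have hvj : v j ∈ W := Submodule.subset_span (Set.mem_range_self j)
      have h := hisoW ⟨x, hxW⟩ ⟨v j, hvj⟩
      rw [← hιW x hxW, hx0] at h
      rw [← h]
      simp [u3mFormQ]
    obtain ⟨g, hg⟩ := (Submodule.mem_span_range_iff_exists_fun ℚ).1 hxW
    have hg0 : g = 0 := eq_zero_of_sum_mul_picardSixteenGram ha hb.ne g fun j => by
      rw [← hpair g j, hg, horth j]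
    rw [← hg, hg0]
    simp

/-- **HC for `S ⊗ S` for a projective K3 surface whose rational transcendental lattice lies in
`U_ℚ² ⊕ ⟨a⟩ ⊕ ⟨b⟩`** (read in a marking; `b < 0`, `a ≠ 0`), modulo Floccari's Thm. 5.11 (ii): the
`k = 2` case of `hodgeConjectureFor_powers_of_transcendental_le_U2ab` transported to `S ⊗ S`. At
`ρ(S) = 16` the crux `PicardThreeK3Squares` is thus known (mod the fact) for every `S` whose
six-dimensional `T(S)_ℚ` (signature `(2,4)`) has Witt index `2`; the residue at `ρ = 16` is the
Witt-index-`1` lattices. [cite: Floccari2026, Thm. 5.11 (§5)] [cite: Varesco2025, Thm. 0.2 = Thm. 4.3 (§4)] -/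
theorem hodgeConjectureFor_square_of_transcendental_le_U2ab
    (hF : Floccari2026_hodgeClasses_algebraic_powers_of_K3_of_transcendental_embedding)
    (hS : IsK3Surface S)
    (η : complexBetti S (2 * 1) ≃ₗ[ℂ] (K3Index → ℂ)) (p : complexBetti S (2 * 2))
    (hp : p ≠ 0) (hpi : IsIntegralClass p)
    (hgen : ∀ q : complexBetti S (2 * 2), IsIntegralClass q → ∃ n : ℤ, q = n • p)
    (hint : ∀ c : complexBetti S (2 * 1), IsIntegralClass c ↔ ∃ v : K3Index → ℤ, η c = fun i => (v i : ℂ))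
    (hcup : ∀ a b : complexBetti S (2 * 1),
      cupProduct (rfl : 2 * 1 + 2 * 1 = 2 * 2) a b = k3Form (η a) (η b) • p)
    {a b : ℤ} (ha : a ≠ 0) (hb : b < 0) (v : Fin 6 → (K3Index → ℚ))
    (hspan : ∀ w : K3Index → ℚ, IsTranscendentalCoord S η w → w ∈ Submodule.span ℚ (Set.range v))
    (hG : ∀ i j, k3FormRat (v i) (v j) = (picardSixteenGram a b i j : ℚ)) :
    HodgeConjectureFor 4 (S ⊗ S) :=
  hodgeConjectureFor_tensor_self_of_pow_two hS.isSmoothProjective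
    (hodgeConjectureFor_powers_of_transcendental_le_U2ab hF hS η p hp hpi hgen hint hcup ha hb v
      hspan hG 2)

end Summit.HodgeConjecture.HodgeConjecture.Theorems.MarkmanPartnerTransport.KugaSatakeSector

end
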